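import Literature.AlgebraicGeometry.Resolution.EmbeddedResolutionExcellentSurfaces
import Literature.AlgebraicGeometry.Resolution.EmbeddedCurvePointBlowups
import Literature.AlgebraicGeometry.Resolution.Blowups
import Mathlib.Topology.GDelta.Basic
import HarnessLib

/-!
# Embedded resolution of curves in a regular surface by blow-ups in closed points
# (The Stacks Project, Lemma 54.15.6 = Tag 0BIC, with Lemma 54.15.1 = Tag 0BI4) — named facts F-75 / F-75c (locus form)

Topic: `Literature/AlgebraicGeometry/Resolution`. Companion of the dimension-2 embedded-resolution facts
`CossartJannsenSaito2020EmbeddedSequenceB` / `…Boundary` / `CossartJannsenSaito2020_canonicalSequence_history`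
(Cossart–Jannsen–Saito 2020) for a CURVE configuration inside a REGULAR SURFACE, in the form printed by the
Stacks Project: finitely many blow-ups IN CLOSED POINTS make the scheme-theoretic inverse image of a nowhere
dense closed subscheme an effective Cartier divisor with strict normal crossings support. Unlike the CJS
sequence (which ends with the strict transform of the curve REGULAR, hence with its components separated),
this statement only asks for strict normal crossings of the total inverse image — the shape wanted by users
who must not blow up points where the configuration already is a strict normal crossing (cell res-hironaka,
rung L W4.2, «PHASE B′»; FACT desk res-dag-4 «F-75», typing brief res-lit-3 (E1)–(E7), 2026-08-27).

## What is printed (The Stacks Project, Chapter 54 «Resolution of Surfaces», §54.15 «Embedded resolution»;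
## section numbers as of 2026-08-27 — the TAGS are the stable locator; texts read by read-only GET, copies
## under the cell's HOME `lit/res-lit-3/f75/tag-*.txt`)

* **Lemma 54.15.1 (Tag 0BI4).** «Let `Y` be a one dimensional integral Noetherian scheme. The following are
  equivalent (1) there exists an alteration `X → Y` with `X` regular, (2) there exists a resolution of
  singularities of `Y`, (3) there exists a finite sequence `Y_n → Y_{n−1} → … → Y_1 → Y` of blowups in closed
  points with `Y_n` regular, and (4) the normalization `Y^ν → Y` is finite.»
* **Lemma 54.15.6 (Tag 0BIC).** «Let `X` be a regular scheme of dimension `2`. Let `Z ⊂ X` be a proper closed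
  subscheme such that every irreducible component `Y ⊂ Z` of dimension `1` satisfies the equivalent conditions
  of Lemma 54.15.1. Then there exists a sequence `X_n → … → X_1 → X` of blowups in closed points such that the
  inverse image `Z_n` of `Z` in `X_n` is an effective Cartier divisor supported on a strict normal crossings
  divisor.» (Strict normal crossings divisor: Étale Morphisms, Def. 41.21.1 = Tag 0BI9 — the tree's
  `IsStrictNormalCrossingsDivisor`, `StrictNormalCrossings.lean`; Lemma 41.21.2 = Tag 0BIA.)
* Hypotheses completed FROM THE PROOF TEXT (typed; each makes the fact weaker than a literal reading):
  «regular scheme» is only locally Noetherian (Properties, Def. 28.9.1 = Tag 02IS), but the proof of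
  Lemma 54.15.5 = Tag 0BIB runs through Lemma 54.4.1 = Tag 0AHH «Let `X` be a Noetherian scheme. Let `T ⊂ X`
  be a finite set of closed points …» and Divisors, Lemma 31.16.8 = Tag 0AGB «Let `X` be a Noetherian scheme
  … When `Z` is nowhere dense in `X` existence of the `D_i` … is guaranteed if … `X` is regular» — so `X`
  is taken NOETHERIAN and «proper closed subscheme» is read as «`Z` NOWHERE DENSE» (on a connected regular `X`
  the two agree; a closed subscheme swallowing a whole connected component never becomes Cartier).
* Proof of 54.15.6, second paragraph (recorded for users; NOT part of the typed statement): «Assume `Z` is an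
  effective Cartier divisor whose irreducible components `Y_i` are regular. … If the maximum of these numbers
  [`m_p(Y_i ∩ Y_j)`] is `> 1`, then we can decrease it (Lemma 54.15.3) by blowing up in all the points `p`
  where the maximum is attained … If the maximum is `1` then … continuing to blowup points where more than
  3 of the components of `Z` meet [sic — read: three or more; the end state is «exactly two curves … and
  `m_p(Y_i ∩ Y_j) = 1`»], we reach the situation where … `Σ Y_i` is a strict normal crossings divisor on the
  regular surface `X`, see Étale Morphisms, Lemma 41.21.2.» The statement fixes neither the order nor the
  locus of the centres.

## What is typed

`Stacks0BIC_embeddedResolutionCurvesInSurfaces` — for `X` a Noetherian scheme all of whose local rings are regular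
(`Scheme.IsRegular`), of dimension `2` (`topologicalKrullDim X = 2`, as in the CJS facts), and EXCELLENT
(`Scheme.IsExcellent` — a SPECIALISATION of the printed finiteness hypothesis: an integral closed curve of an
excellent scheme is excellent, hence its normalization is finite, i.e. 54.15.1 (4) holds; cf. the tree's
`exists_embeddedResolution_of_curve`, which works with quasi-excellent curves), and `Z` a closed subscheme of
`X` (Mathlib `Scheme.IdealSheafData`) whose support is NOWHERE DENSE (Mathlib `IsNowhereDense`): there are a
scheme `X'` and `π : X' ⟶ X` which is a finite composition of blowing ups at closed points — the tree's
`IsPointBlowupComposition Set.univ π` (`EmbeddedCurvePointBlowups.lean`, Liu 9.2.32's «morphism made up of a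
finite sequence of blowing-ups of closed points»; locus `Set.univ` = no constraint, as printed) — such that the
scheme-theoretic inverse image of `Z` (Mathlib's pull-back ideal sheaf `Z.comap π`) is an effective Cartier
divisor (`IsEffectiveCartier`, `Blowups.lean`) and its support `π⁻¹(V(Z))` is a strict normal crossings divisor
on `X'` (`IsStrictNormalCrossingsDivisor`; set level = «`(Z_n)_red` is snc», exact by Tag 0BIA since an snc
divisor is reduced — `Z_n` itself carries exceptional multiplicities).

FLAGS. (i) WEAKER THAN PRINT / COMPLETED FROM THE PROOF: Noetherian; «nowhere dense» for «proper»; excellence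
for «finite normalization of the 1-dimensional components». (ii) ∃-FORM ONLY: which closed points are blown up
(singular points of the components, then points with `m_p > 1`, then points on three or more components —
never a point where the configuration is already a strict normal crossing) and that they lie over `Z` is
running text of the proofs (Tags 0BIB/0BIC/0AHH) and is NOT asserted here; a user who needs locus or order as
a premise asks for the separate CONSTRUCTION-fact (desk label F-75c). (iii) Not a statement of H. Hironaka's
2017 manuscript; a published lemma typed for the L-lane of cell res-hironaka. No definitions, instances or
notation introduced. AI-typed; weaker than expert review. Statement only (`def … : Prop`); users take
`(h : Stacks0BIC_embeddedResolutionCurvesInSurfaces)`.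

LOCUS FORM (appended 2026-08-27, desk label F-75c, flag CONSTRUCTION):
`Stacks0BIC_embeddedResolutionCurvesInSurfaces_locus` — same binders, with the composition of point blowing
ups lying over `V(Z)` (`IsPointBlowupComposition (Z.support : Set X) π`): this is what the printed PROOFS do
(Tags 0BIB/0AHH: centres «lying above a point of `T`», `T ⊆ V(Z)`; 0BI4/0BI5: singular points of the components
of `Z`; 0BIC ¶1–¶2: points `p ∈ Y_i ∩ Y_j` of the current inverse image of `Z`, which is «supported on the
strict transform of `Z` and the exceptional divisor»), but NOT what the statement of 54.15.6 says — hence the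
flag. Still no ORDER of centres. `stacks0BIC_of_locus` (PROVED, proof append): the locus form implies F-75. Asked for by a
user who measures a surface state by the least length of such a composition and needs the exceptional curve
of the first step to lie inside the inverse image of `Z` (cell res-hironaka, rung L W4.2, 2026-08-27).

## References

* The Stacks Project, Tag 0BIC (Lemma 54.15.6), Tag 0BI4 (Lemma 54.15.1), Tag 0BIB (Lemma 54.15.5),
  Tag 0AHH (Lemma 54.4.1), Tag 0AGB (Lemma 31.16.8), Tag 02IS (Def. 28.9.1), Tag 0BI9 (Def. 41.21.1),
  Tag 0BIA (Lemma 41.21.2). [StacksProject]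
* Related print (NOT the source of this decl): J. Kollár, *Lectures on Resolution of Singularities* (2007),
  Algorithm 1.46 / Thm. 1.47 (any-order strong embedded resolution; smooth surface over a PERFECT field);
  Q. Liu, *Algebraic Geometry and Arithmetic Curves* (2002), Thm. 9.2.26 (regular fibered surfaces over a
  Dedekind scheme), Lemma 9.2.32 (= the tree's `exists_embeddedResolution_of_curve`). [Kollar2007] [Liu2002]
-/

noncomputable section

open CategoryTheory AlgebraicGeometry TopologicalSpace

namespace Literature.AlgebraicGeometry.Resolution

universe u

open Scheme.IdealSheafData

/-- NAMED FACT (F-75) — **The Stacks Project, Lemma 54.15.6 (Tag 0BIC): embedded resolution of curves in a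
regular surface by blow-ups in closed points.** «Let `X` be a regular scheme of dimension `2`. Let `Z ⊂ X` be a
proper closed subscheme such that every irreducible component `Y ⊂ Z` of dimension `1` satisfies the equivalent
conditions of Lemma 54.15.1 [Tag 0BI4; (4): «the normalization `Y^ν → Y` is finite»]. Then there exists a
sequence `X_n → … → X_1 → X` of blowups in closed points such that the inverse image `Z_n` of `Z` in `X_n` is an
effective Cartier divisor supported on a strict normal crossings divisor.» Vendored for `X` Noetherian with all
local rings regular, `topologicalKrullDim X = 2` and `X` EXCELLENT (specialisation of 54.15.1 (4)), `Z` a closed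
subscheme with NOWHERE DENSE support («proper», as used in the proof via Tags 0BIB/0AGB): there are `X'` and a
finite composition `π : X' ⟶ X` of blowing ups at closed points (`IsPointBlowupComposition Set.univ π`) such
that the pull-back ideal sheaf `Z.comap π` is an effective Cartier divisor and `π⁻¹(V(Z))` is a strict normal
crossings divisor on `X'`. Weaker than the source (Noetherian, nowhere dense, excellent); neither the order nor
the locus of the centres is asserted. Statement only; users take `(h : Stacks0BIC_embeddedResolutionCurvesInSurfaces)`.
-- TODO(general form): «every 1-dimensional irreducible component of `Z` has finite normalization» (54.15.1 (4))
-- instead of `Scheme.IsExcellent X`; locally Noetherian `X` with «proper» read literally on integral `X`.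
[cite: StacksProject, Tag 0BIC (Lemma 54.15.6); Tag 0BI4 (Lemma 54.15.1 (4)); Tag 0BI9 (Def. 41.21.1)] -/
def Stacks0BIC_embeddedResolutionCurvesInSurfaces : Prop :=
  ∀ (X : Scheme.{u}) [IsNoetherian X] (Z : X.IdealSheafData),
    Scheme.IsRegular X → Scheme.IsExcellent X → topologicalKrullDim X = 2 →
    IsNowhereDense (Z.support : Set X) →
      ∃ (X' : Scheme.{u}) (π : X' ⟶ X), IsPointBlowupComposition Set.univ π ∧
        IsEffectiveCartier (Z.comap π) ∧
        IsStrictNormalCrossingsDivisor X' (π ⁻¹' (Z.support : Set X))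

/-! ## The locus form (desk label F-75c): all centres lie over `V(Z)` — CONSTRUCTION flag -/

/-- NAMED FACT (F-75c, CONSTRUCTION) — **The Stacks Project, Lemma 54.15.6 (Tag 0BIC), with the LOCUS
of the centres read from its PROOF: every blown-up closed point lies over `V(Z)`.** The printed STATEMENT
of Lemma 54.15.6 fixes no locus; the printed CONSTRUCTION does: each centre is a closed point of the
current inverse image of `Z` — Lemma 54.15.5 (Tag 0BIB), proof: «we can write `𝓘_Z = 𝓘_{Z'} 𝓘_D` where
`Z' ⊂ X` is a closed subscheme which set theoretically consists of finitely many closed points. Applying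
Lemma 54.4.1» with Lemma 54.4.1 (Tag 0AHH) «`X_{i+1} → X_i` is the blowing up of `X_i` at a closed point
lying above a point of `T`» (`T = Z' ⊆ V(Z)`); Lemma 54.15.1 (Tag 0BI4), proof of (3): «we pick a singular
closed point `y_{i−1} ∈ Y_{i−1}` and we let `Y_i → Y_{i−1}` be the corresponding blowup» (`Y` an irreducible
component of `Z`) with Lemma 54.15.2 (Tag 0BI5) «the corresponding sequence of blowups of `X`»; Lemma
54.15.6, proof ¶1 «the inverse image `Z' ⊂ X'` of `Z` is supported on the strict transform of `Z` and the
exceptional divisor» and ¶2 «`p ∈ Y_i ∩ Y_j` … blowing up in all the points `p` where the maximum is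
attained … continuing to blowup points where more than 3 [sic — read: three or more] of the components of
`Z` meet». Vendored with the binders of `Stacks0BIC_embeddedResolutionCurvesInSurfaces` (Noetherian, all
local rings regular, excellent, `topologicalKrullDim X = 2`, `Z` with nowhere dense support) and the
conclusion strengthened in ONE clause: the composition of point blowing ups lies over the support of `Z`
(`IsPointBlowupComposition (Z.support : Set X) π`: each centre is a proper closed point of its stage mapping
into `V(Z) ⊆ X`). No ORDER of the centres is asserted. FLAG «CONSTRUCTION»: the locus clause is PROOF TEXT of
Tags 0BIB/0AHH/0BI4/0BI5/0BIC, not part of the printed statement; a verdict consuming this fact carries the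
flag. It implies F-75 (`stacks0BIC_of_locus`, proof append). Statement only; users take
`(h : Stacks0BIC_embeddedResolutionCurvesInSurfaces_locus)`.
[cite: StacksProject, Tag 0BIC (Lemma 54.15.6, proof); Tag 0BIB (Lemma 54.15.5, proof); Tag 0AHH (Lemma 54.4.1)] -/
def Stacks0BIC_embeddedResolutionCurvesInSurfaces_locus : Prop :=
  ∀ (X : Scheme.{u}) [IsNoetherian X] (Z : X.IdealSheafData),
    Scheme.IsRegular X → Scheme.IsExcellent X → topologicalKrullDim X = 2 →
    IsNowhereDense (Z.support : Set X) →
      ∃ (X' : Scheme.{u}) (π : X' ⟶ X), IsPointBlowupComposition (Z.support : Set X) π ∧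
        IsEffectiveCartier (Z.comap π) ∧
        IsStrictNormalCrossingsDivisor X' (π ⁻¹' (Z.support : Set X))

/-- The locus form implies the printed ∃-form of Lemma 54.15.6 = F-75 (forget the locus:
`IsPointBlowupComposition.mono`) — the printed statement follows from the printed construction.
[cite: StacksProject, Tag 0BIC (Lemma 54.15.6)] -/
theorem stacks0BIC_of_locus (h : Stacks0BIC_embeddedResolutionCurvesInSurfaces_locus.{u}) :
    Stacks0BIC_embeddedResolutionCurvesInSurfaces.{u} := by
  intro X _ Z hreg hexc hdim hZ
  obtain ⟨X', π, hπ, hcart, hsnc⟩ := h X Z hreg hexc hdim hZ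
  exact ⟨X', π, hπ.mono (Set.subset_univ _), hcart, hsnc⟩

end Literature.AlgebraicGeometry.Resolution

end
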